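/-
Origin: expansion seat `planner-pub-hodgecm-mc-glue-1-g11-0`, handover #SG3 2026-08-20T16:55:47Z md5 84f971fe31cf (REPLACE; pre md5 0467d53e3c1c → new md5 84f971fe31cf; 264 l.; (μ4) scope-guard rewrite of the RUN-55 installed file; family binder-1; compiled ok 0 proof-hole) (`HOME/mc/pub-hodgecm-mc-glue-1-g11/stage56/HodgeCM/Model/Binders/Real34PinsROG.lean`, md5 84f971fe31cf, 264 lines);
landed by the second packager p2 gen 10 (p2-g10) in gate run 56 REPLACES the earlier landed copy of `HodgeCM/Model/Binders/Real34PinsROG.lean` (seat copy carried the packager Origin header of an earlier run (stripped)).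
-/
/-
Origin: speedrun cell pub-hodgecm, MODEL-CONSTRUCTION sub-cell, unit pub-hodgecm-mc-binder-1-g11 (BINDER PROVER, gen 11; S RE-PIN P3 of K34-PLAN §3 for
row 17, and rows 16/17 IN E's TEXT at the (J-η) pins), seat prover-pub-hodgecm-mc-binder-1-g11-0, 2026-08-20.  Target in PKG:
HodgeCM/Model/Binders/Real34PinsROG.lean (NEW additive leaf; imports `Binders/Real34PinsTotalPK` (this kit) + #37 `Binders/Gen12PinsROG` (RUN 43) +
binder-2 #56 `HypCensus/HypOfCensus` (RUN 42, `HypCensus.Wcm`) + glue-1 `E2InstanceOGR8` (`thetaSub_of_factOG`)).  KERNEL ONLY: theorems only;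
0 records, nothing cited, 0 `def … : Prop`, MODEL-N ±0, E unchanged.  Nothing here is a claim of the manuscripts under adjudication.
-/
import Summits.HodgeConjecture.HodgeCM.Model.Binders.Real34PinsTotalPK
import Summits.HodgeConjecture.HodgeCM.Model.Binders.Gen12PinsROG
import Summits.HodgeConjecture.HodgeCM.Model.HypCensus.HypOfCensus
import Summits.HodgeConjecture.HodgeCM.Model.E2InstanceOGR8

/-!
# Rows 16/17 (`gen12`/`real34`) at glue-1's pins `W := HypCensus.Wcm hGR η_S hη_S hηc_S`, `S := SInstance.SROG …`

`SROG @hGR @χV @hGR₀..₃ @μ hΔ₁ hΔ₂ hΔ₃ = SGP @GOG @hG_GOG @hGR @η_S @hη_S @hηc_S @hGR₀..₃ @(AR …)`, `η_S := EtaChi.η @χV (χWR @hGR @hGR₀ @hGR₁ @μ)`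
(sinst-1 #1212), and `HypCensus.Wcm hGR η_S hη_S hηc_S = Gen12Pins.Wg @hGR @η_S @hη_S @hηc_S @τSyl @TSyl @hTSyl` (`rfl`, #32).  Hence:

* § 1 **`real34_ROG_of_GOG`** — row 17 PER CONTEXT on the guard `hg : SInstance.GOG V c` (bit `h` free): `Real34PinsTotalPK.real34_totalKSAt` at
  `G := GOG`, `AG := AR`, the (N1)₂,₃ weights of `AR` being `archLineInputOf_w` (`rfl`); hypotheses AT THE CONTEXT: `hc : GoodCtx`, `hK`, C3₂,₃
  `hU₂ hU₃`, and ONE `Gen12PinsP.Real34CensusSide` (binder-2's (34) census core ⊕ `hwedge`); variants `…_of_kTypeDatum` / `…_of_kTypeDatumT`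
  over #28's data `D` / `DT` instead of `CS`.
* § 2 **rows 16/17 IN E's OWN TEXT at the (J-η) pins** (bit `orientBitι L ι₁` pointwise, canonical representative `(mk ι₁).embedding = ι₁` among the
  row's hypotheses — E `perL_picardCM_r21AEOGI` / #395 / #396 shape; the guard `GOG V c` is READ OFF the row's own hypotheses by
  `⟨hcan, (AdelicThetaCore.thetaModel_goodCtx_iff …).mp hc⟩`, exactly as glue-1's `…OGISC` reads it for rows 12/14/15):
  **`gen12_ROGE`** — row 16 with NO residual hypothesis; **`real34_ROGE (h31) (hLiu) (CS)`** — row 17 from E's CM-inflation fact `h31`, an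
  `hLiu` family in the OG text (glue-1 `thetaSub_of_factOG`) and ONE census side per good sextic canonical context.
  REQUIREMENT on the E child (binder-1 06:51:26Z, sinst-1 (J-η) 06:51:40Z): W's character IS the S pin's `η_S` — the see-saw identity couples
  `W.ρ` and the line representations of `S` through one splitting character.
-/

set_option autoImplicit false

noncomputable section

open MeasureTheory NumberField

namespace HodgeCM.Model

open HodgeCM HodgeCM.Universe HodgeCM.Adelic
open Literature.NumberTheory.Weil1964
open Literature.NumberTheory.Automorphic (piSchwartzBruhat archWeight)
open Literature.NumberTheory.GelbartRogawski1991.UnitaryDualPair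
open Literature.AlgebraicGeometry.HodgeTheory
open Literature.NumberTheory.Automorphic.PicardCM
open Literature.NumberTheory.Transcendental (Arapura2012_Cor_15_4_6)
open HodgeCM.CMTypeOps (inflate)
open HodgeCM.Model.ThetaSpace
open HodgeCM.Model.ArchSideTerm

namespace Gen12PinsP

variable
  (hGR : ∀ {L : CMField} {ι₁ : L →+* ℂ} (V : HermSpace3 L ι₁) (c : SeesawCtx L),
    (cmSplittingDatum (L : Type) finProdFinEquiv (frameD V) (frameD_real V) (frameD_ne V) (dW c.D) (dW_real c.D)
      (dW_ne c.D)).CompatibleSplitting)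
  (χV : ∀ {L : CMField} {ι₁ : L →+* ℂ} (_V : HermSpace3 L ι₁) (_c : SeesawCtx L),
    ContinuousMonoidHom (relNormOneIdeles (↥(NumberField.maximalRealSubfield (L : Type))) (L : Type) ⧸
      relNormOneRat (↥(NumberField.maximalRealSubfield (L : Type))) (L : Type)) Circle)
  (hGR₀ : ∀ {L : CMField} {ι₁ : L →+* ℂ} (V : HermSpace3 L ι₁) (c : SeesawCtx L),
    (cmSplittingDatum (L : Type) (e₁) (frameD V) (frameD_real V) (frameD_ne V) (lineVec (L : Type) (dW c.D 0))
      (fun _ => dW_real c.D 0) (fun _ => dW_ne c.D 0)).CompatibleSplitting)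
  (hGR₁ : ∀ {L : CMField} {ι₁ : L →+* ℂ} (V : HermSpace3 L ι₁) (c : SeesawCtx L),
    (cmSplittingDatum (L : Type) (e₁) (frameD V) (frameD_real V) (frameD_ne V) (lineVec (L : Type) (dW c.D 1))
      (fun _ => dW_real c.D 1) (fun _ => dW_ne c.D 1)).CompatibleSplitting)
  (hGR₂ : ∀ {L : CMField} {ι₁ : L →+* ℂ} (V : HermSpace3 L ι₁) (c : SeesawCtx L),
    (cmSplittingDatum (L : Type) (e₁) (frameD V) (frameD_real V) (frameD_ne V) (lineVec (L : Type) (dW' c.D 0))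
      (fun _ => dW'_real c.D 0) (fun _ => dW'_ne c.D 0)).CompatibleSplitting)
  (hGR₃ : ∀ {L : CMField} {ι₁ : L →+* ℂ} (V : HermSpace3 L ι₁) (c : SeesawCtx L),
    (cmSplittingDatum (L : Type) (e₁) (frameD V) (frameD_real V) (frameD_ne V) (lineVec (L : Type) (dW' c.D 1))
      (fun _ => dW'_real c.D 1) (fun _ => dW'_ne c.D 1)).CompatibleSplitting)
  (μ : ∀ {L : CMField}, SeesawCtx L → Fin 4 → NumberField.InfinitePlace (L : Type) → ℤ)
  (hΔ₁ : ∀ {L : CMField} {ι₁ : L →+* ℂ} (V : HermSpace3 L ι₁) (c : SeesawCtx L), ∀ hc : SInstance.GOG V c,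
    slotTypeVec V c (hGR V c) (hGR₀ V c) (hGR₁ V c) (hGR₂ V c) (hGR₃ V c) (SInstance.hG_GOG V c hc) 1 -
      slotTypeVec V c (hGR V c) (hGR₀ V c) (hGR₁ V c) (hGR₂ V c) (hGR₃ V c) (SInstance.hG_GOG V c hc) 0 = μ c 1 - μ c 0)
  (hΔ₂ : ∀ {L : CMField} {ι₁ : L →+* ℂ} (V : HermSpace3 L ι₁) (c : SeesawCtx L), ∀ hc : SInstance.GOG V c,
    slotTypeVec V c (hGR V c) (hGR₀ V c) (hGR₁ V c) (hGR₂ V c) (hGR₃ V c) (SInstance.hG_GOG V c hc) 2 -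
      slotTypeVec V c (hGR V c) (hGR₀ V c) (hGR₁ V c) (hGR₂ V c) (hGR₃ V c) (SInstance.hG_GOG V c hc) 0 = μ c 2 - μ c 0)
  (hΔ₃ : ∀ {L : CMField} {ι₁ : L →+* ℂ} (V : HermSpace3 L ι₁) (c : SeesawCtx L), ∀ hc : SInstance.GOG V c,
    slotTypeVec V c (hGR V c) (hGR₀ V c) (hGR₁ V c) (hGR₂ V c) (hGR₃ V c) (SInstance.hG_GOG V c hc) 3 -
      slotTypeVec V c (hGR V c) (hGR₀ V c) (hGR₁ V c) (hGR₂ V c) (hGR₃ V c) (SInstance.hG_GOG V c hc) 0 = μ c 3 - μ c 0)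

variable (hHD : exists_isReal_hodgeModel) (hI : hodgePQ_independent_of_hodgeModel)
  (h₁ : BallQuotientUniformised)  (h₃ : CMAbelianVarietyRealised)
  (h : Bool) (hA : Arapura2012_Cor_15_4_6)

/- the pins, spelled out: η_S := `@EtaChi.η @χV (@SInstance.χWR @hGR @hGR₀ @hGR₁ @μ)` (likewise `hη_S`, `hηc_S`),
   W := `Gen12Pins.Wg @hGR η_S hη_S hηc_S @Gen12Pins.τSyl @Gen12Pins.TSyl @Gen12Pins.hTSyl` (= `HypCensus.Wcm hGR η_S hη_S hηc_S`, rfl),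
   S := `SInstance.SROG @hGR @χV @hGR₀ @hGR₁ @hGR₂ @hGR₃ @μ hΔ₁ hΔ₂ hΔ₃`
     (= `SInstance.SGP @SInstance.GOG @SInstance.hG_GOG @hGR η_S hη_S hηc_S @hGR₀..₃ @(SInstance.AR … @SInstance.hpos_GOG hΔ₁ hΔ₂ hΔ₃)`, rfl). -/

/-! ## 1. Row 17 per context on the guard `GOG` -/

section Pointwise

variable {L : CMField} {ι₁ : L →+* ℂ} (V : HermSpace3 L ι₁) (c : SeesawCtx L)

/-- (N1) at the read-off pin: every line weight of `SInstance.AR` is `archWeight L (μ c k)` (theta-3 (E1) `archLineInputOf_w`, `rfl`). -/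
theorem hAw_AR (hg : SInstance.GOG V c) (k : Fin 4) :
    (SInstance.AR @SInstance.GOG @SInstance.hG_GOG @hGR @χV @hGR₀ @hGR₁ @hGR₂ @hGR₃ @μ @SInstance.hpos_GOG
        (fun V c hc => hΔ₁ V c hc) (fun V c hc => hΔ₂ V c hc) (fun V c hc => hΔ₃ V c hc) V c hg k).w =
      ⇑(Literature.NumberTheory.Automorphic.archWeight (L : Type) (μ c k)) :=
  ArchSideTerm.archLineInputOf_w _ k

/-- **Row 17 ON THE GUARD at glue-1's S pin `SROG`, from the (34) CENSUS SIDE of the context** (pointwise; bit `h` free): at a good sextic context with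
`hg : GOG V c`, C3₂,₃ `hU₂ hU₃` at the context and ONE `Gen12PinsP.Real34CensusSide` (mc-binder-2's (34) census core at the W pin ⊕ the wedge
decomposition `hwedge` of its inserted printed vectors over `adm₃₄`-admissible frames of lines 2, 3 of `SROG V c`), E's `Real34FunBridge V c` for
the model at `W := Wg @hGR @η_S @hη_S @hηc_S @τSyl @TSyl @hTSyl`, `S := SROG …` is inhabited.  (L3), (N1)₂,₃, the see-saw junctions and the universe
facts are all discharged below this line (`Real34PinsTotalPK.real34_totalKSAt`). -/
theorem real34_ROG_of_GOG (hg : SInstance.GOG V c)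
    (hc : (pinT hHD hI h₁ h₃ h hA
      (Gen12Pins.Wg @hGR (@EtaChi.η @χV (@SInstance.χWR @hGR @hGR₀ @hGR₁ @μ)) (@EtaChi.hη @χV (@SInstance.χWR @hGR @hGR₀ @hGR₁ @μ))
        (@EtaChi.hηc @χV (@SInstance.χWR @hGR @hGR₀ @hGR₁ @μ)) @Gen12Pins.τSyl @Gen12Pins.TSyl @Gen12Pins.hTSyl)
      (SInstance.SROG @hGR @χV @hGR₀ @hGR₁ @hGR₂ @hGR₃ @μ hΔ₁ hΔ₂ hΔ₃) μ).GoodCtx ι₁ c)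
    (hK : Module.finrank ℚ c.K = 6)
    (hU₂ : ∀ Γ : Level V, (pinT hHD hI h₁ h₃ h hA
      (Gen12Pins.Wg @hGR (@EtaChi.η @χV (@SInstance.χWR @hGR @hGR₀ @hGR₁ @μ)) (@EtaChi.hη @χV (@SInstance.χWR @hGR @hGR₀ @hGR₁ @μ))
        (@EtaChi.hηc @χV (@SInstance.χWR @hGR @hGR₀ @hGR₁ @μ)) @Gen12Pins.τSyl @Gen12Pins.TSyl @Gen12Pins.hTSyl)
      (SInstance.SROG @hGR @χV @hGR₀ @hGR₁ @hGR₂ @hGR₃ @μ hΔ₁ hΔ₂ hΔ₃) μ).Theta V c 2 Γ ⊆ (picardCMUniverse hHD hI h₁ h₃).Uiso Γ c.K (c.Ψ 2) c.σ)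
    (hU₃ : ∀ Γ : Level V, (pinT hHD hI h₁ h₃ h hA
      (Gen12Pins.Wg @hGR (@EtaChi.η @χV (@SInstance.χWR @hGR @hGR₀ @hGR₁ @μ)) (@EtaChi.hη @χV (@SInstance.χWR @hGR @hGR₀ @hGR₁ @μ))
        (@EtaChi.hηc @χV (@SInstance.χWR @hGR @hGR₀ @hGR₁ @μ)) @Gen12Pins.τSyl @Gen12Pins.TSyl @Gen12Pins.hTSyl)
      (SInstance.SROG @hGR @χV @hGR₀ @hGR₁ @hGR₂ @hGR₃ @μ hΔ₁ hΔ₂ hΔ₃) μ).Theta V c 3 Γ ⊆ (picardCMUniverse hHD hI h₁ h₃).Uiso Γ c.K (c.Ψ 3) c.σ)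
    (CS : Real34CensusSide @SInstance.GOG @SInstance.hG_GOG @hGR (@EtaChi.η @χV (@SInstance.χWR @hGR @hGR₀ @hGR₁ @μ))
      (@EtaChi.hη @χV (@SInstance.χWR @hGR @hGR₀ @hGR₁ @μ)) (@EtaChi.hηc @χV (@SInstance.χWR @hGR @hGR₀ @hGR₁ @μ)) @hGR₀ @hGR₁ @hGR₂ @hGR₃
      (@SInstance.AR @SInstance.GOG @SInstance.hG_GOG @hGR @χV @hGR₀ @hGR₁ @hGR₂ @hGR₃ @μ @SInstance.hpos_GOG
        (fun V c hc => hΔ₁ V c hc) (fun V c hc => hΔ₂ V c hc) (fun V c hc => hΔ₃ V c hc))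
      hHD hI h₁ h₃ @μ V c (isAnisotropic_of_goodCtx V hc hK)) :
    Nonempty ((pinT hHD hI h₁ h₃ h hA
      (Gen12Pins.Wg @hGR (@EtaChi.η @χV (@SInstance.χWR @hGR @hGR₀ @hGR₁ @μ)) (@EtaChi.hη @χV (@SInstance.χWR @hGR @hGR₀ @hGR₁ @μ))
        (@EtaChi.hηc @χV (@SInstance.χWR @hGR @hGR₀ @hGR₁ @μ)) @Gen12Pins.τSyl @Gen12Pins.TSyl @Gen12Pins.hTSyl)
      (SInstance.SROG @hGR @χV @hGR₀ @hGR₁ @hGR₂ @hGR₃ @μ hΔ₁ hΔ₂ hΔ₃) μ).Real34FunBridge V c) :=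
  real34_totalKSAt @SInstance.GOG @SInstance.hG_GOG @hGR (@EtaChi.η @χV (@SInstance.χWR @hGR @hGR₀ @hGR₁ @μ))
    (@EtaChi.hη @χV (@SInstance.χWR @hGR @hGR₀ @hGR₁ @μ)) (@EtaChi.hηc @χV (@SInstance.χWR @hGR @hGR₀ @hGR₁ @μ))
    @hGR₀ @hGR₁ @hGR₂ @hGR₃
    (@SInstance.AR @SInstance.GOG @SInstance.hG_GOG @hGR @χV @hGR₀ @hGR₁ @hGR₂ @hGR₃ @μ @SInstance.hpos_GOG
      (fun V c hc => hΔ₁ V c hc) (fun V c hc => hΔ₂ V c hc) (fun V c hc => hΔ₃ V c hc))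
    hHD hI h₁ h₃ h hA @μ V c (isAnisotropic_of_goodCtx V hc hK) hg hc (fun k _ => ArchSideTerm.archLineInputOf_w _ k) hU₂ hU₃ CS

/-- **Row 17 on the guard at `SROG`, from the K-type datum `D`** (#28's `Real34KTypeDatum` at the pins; (L3), (N1), universe facts discharged). -/
theorem real34_ROG_of_GOG_of_kTypeDatum (hg : SInstance.GOG V c)
    (hc : (pinT hHD hI h₁ h₃ h hA
      (Gen12Pins.Wg @hGR (@EtaChi.η @χV (@SInstance.χWR @hGR @hGR₀ @hGR₁ @μ)) (@EtaChi.hη @χV (@SInstance.χWR @hGR @hGR₀ @hGR₁ @μ))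
        (@EtaChi.hηc @χV (@SInstance.χWR @hGR @hGR₀ @hGR₁ @μ)) @Gen12Pins.τSyl @Gen12Pins.TSyl @Gen12Pins.hTSyl)
      (SInstance.SROG @hGR @χV @hGR₀ @hGR₁ @hGR₂ @hGR₃ @μ hΔ₁ hΔ₂ hΔ₃) μ).GoodCtx ι₁ c)
    (hK : Module.finrank ℚ c.K = 6)
    (hU₂ : ∀ Γ : Level V, (pinT hHD hI h₁ h₃ h hA
      (Gen12Pins.Wg @hGR (@EtaChi.η @χV (@SInstance.χWR @hGR @hGR₀ @hGR₁ @μ)) (@EtaChi.hη @χV (@SInstance.χWR @hGR @hGR₀ @hGR₁ @μ))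
        (@EtaChi.hηc @χV (@SInstance.χWR @hGR @hGR₀ @hGR₁ @μ)) @Gen12Pins.τSyl @Gen12Pins.TSyl @Gen12Pins.hTSyl)
      (SInstance.SROG @hGR @χV @hGR₀ @hGR₁ @hGR₂ @hGR₃ @μ hΔ₁ hΔ₂ hΔ₃) μ).Theta V c 2 Γ ⊆ (picardCMUniverse hHD hI h₁ h₃).Uiso Γ c.K (c.Ψ 2) c.σ)
    (hU₃ : ∀ Γ : Level V, (pinT hHD hI h₁ h₃ h hA
      (Gen12Pins.Wg @hGR (@EtaChi.η @χV (@SInstance.χWR @hGR @hGR₀ @hGR₁ @μ)) (@EtaChi.hη @χV (@SInstance.χWR @hGR @hGR₀ @hGR₁ @μ))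
        (@EtaChi.hηc @χV (@SInstance.χWR @hGR @hGR₀ @hGR₁ @μ)) @Gen12Pins.τSyl @Gen12Pins.TSyl @Gen12Pins.hTSyl)
      (SInstance.SROG @hGR @χV @hGR₀ @hGR₁ @hGR₂ @hGR₃ @μ hΔ₁ hΔ₂ hΔ₃) μ).Theta V c 3 Γ ⊆ (picardCMUniverse hHD hI h₁ h₃).Uiso Γ c.K (c.Ψ 3) c.σ)
    (D : Real34KTypeDatum hHD hI h₁ h₃ h hA
      (Gen12Pins.Wg @hGR (@EtaChi.η @χV (@SInstance.χWR @hGR @hGR₀ @hGR₁ @μ)) (@EtaChi.hη @χV (@SInstance.χWR @hGR @hGR₀ @hGR₁ @μ))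
        (@EtaChi.hηc @χV (@SInstance.χWR @hGR @hGR₀ @hGR₁ @μ)) @Gen12Pins.τSyl @Gen12Pins.TSyl @Gen12Pins.hTSyl)
      (SInstance.SROG @hGR @χV @hGR₀ @hGR₁ @hGR₂ @hGR₃ @μ hΔ₁ hΔ₂ hΔ₃) μ V c (isAnisotropic_of_goodCtx V hc hK)
      (SeesawHyp34.ofGuarded @SInstance.GOG @SInstance.hG_GOG @hGR (@EtaChi.η @χV (@SInstance.χWR @hGR @hGR₀ @hGR₁ @μ))
        (@EtaChi.hη @χV (@SInstance.χWR @hGR @hGR₀ @hGR₁ @μ)) (@EtaChi.hηc @χV (@SInstance.χWR @hGR @hGR₀ @hGR₁ @μ)) @hGR₀ @hGR₁ @hGR₂ @hGR₃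
        (@SInstance.AR @SInstance.GOG @SInstance.hG_GOG @hGR @χV @hGR₀ @hGR₁ @hGR₂ @hGR₃ @μ @SInstance.hpos_GOG
          (fun V c hc => hΔ₁ V c hc) (fun V c hc => hΔ₂ V c hc) (fun V c hc => hΔ₃ V c hc)) V c hg)
      (adm₃₄ hHD hI h₁ h₃ ((SInstance.SROG @hGR @χV @hGR₀ @hGR₁ @hGR₂ @hGR₃ @μ hΔ₁ hΔ₂ hΔ₃) V c) (isAnisotropic_of_goodCtx V hc hK))) :
    Nonempty ((pinT hHD hI h₁ h₃ h hA
      (Gen12Pins.Wg @hGR (@EtaChi.η @χV (@SInstance.χWR @hGR @hGR₀ @hGR₁ @μ)) (@EtaChi.hη @χV (@SInstance.χWR @hGR @hGR₀ @hGR₁ @μ))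
        (@EtaChi.hηc @χV (@SInstance.χWR @hGR @hGR₀ @hGR₁ @μ)) @Gen12Pins.τSyl @Gen12Pins.TSyl @Gen12Pins.hTSyl)
      (SInstance.SROG @hGR @χV @hGR₀ @hGR₁ @hGR₂ @hGR₃ @μ hΔ₁ hΔ₂ hΔ₃) μ).Real34FunBridge V c) :=
  real34_totalKAt @SInstance.GOG @SInstance.hG_GOG @hGR (@EtaChi.η @χV (@SInstance.χWR @hGR @hGR₀ @hGR₁ @μ))
    (@EtaChi.hη @χV (@SInstance.χWR @hGR @hGR₀ @hGR₁ @μ)) (@EtaChi.hηc @χV (@SInstance.χWR @hGR @hGR₀ @hGR₁ @μ))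
    @hGR₀ @hGR₁ @hGR₂ @hGR₃
    (@SInstance.AR @SInstance.GOG @SInstance.hG_GOG @hGR @χV @hGR₀ @hGR₁ @hGR₂ @hGR₃ @μ @SInstance.hpos_GOG
      (fun V c hc => hΔ₁ V c hc) (fun V c hc => hΔ₂ V c hc) (fun V c hc => hΔ₃ V c hc))
    hHD hI h₁ h₃ h hA @μ V c (isAnisotropic_of_goodCtx V hc hK) hg hc (fun k _ => ArchSideTerm.archLineInputOf_w _ k) hU₂ hU₃ D

end Pointwise

/-! ## 2. Rows 16/17 in E's own text at the (J-η) pins -/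

/-- **Row 16 (`gen12`) IN E's OWN TEXT at the pins `W := HypCensus.Wcm hGR η_S hη_S hηc_S`, `S := SInstance.SROG …`, bit `orientBitι L ι₁` — NO
residual hypothesis.**  The canonical-representative hypothesis `(mk ι₁).embedding = ι₁` of the row and its good context give the guard
`SInstance.GOG V c` (`AdelicThetaCore.thetaModel_goodCtx_iff`); then #37 `gen12_ROG_of_GOG`.  (`h₃` is generic; E instantiates it at
`cmAbelianVarietyRealised_of_eigenbasis hHD hI h₃`.) -/
theorem gen12_ROGE :
    ∀ {L : CMField} {ι₁ : L →+* ℂ} (V : HermSpace3 L ι₁) (c : SeesawCtx L),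
      (thetaModelOf hHD hI h₁ h₃ (orientBitι L ι₁) (embOf hHD hI h₁ h₃) (coverOf hHD hI h₁ h₃ hA)
        (wmOfInput (HypCensus.Wcm hGR (@EtaChi.η @χV (@SInstance.χWR @hGR @hGR₀ @hGR₁ @μ)) (@EtaChi.hη @χV (@SInstance.χWR @hGR @hGR₀ @hGR₁ @μ))
          (@EtaChi.hηc @χV (@SInstance.χWR @hGR @hGR₀ @hGR₁ @μ))))
        (thetaOf _ (thetaClassInputOf _ (fun V c => thetaSpaceInputOf hHD hI h₁ h₃ (SInstance.SROG @hGR @χV @hGR₀ @hGR₁ @hGR₂ @hGR₃ @μ hΔ₁ hΔ₂ hΔ₃) V c)))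
        (d12Of μ) (d34Of μ)).GoodCtx ι₁ c → Module.finrank ℚ c.K = 6 ∧ IsNormalClosure ℚ c.K L ∧ (Module.finrank ℚ L = 24 ∨ Module.finrank ℚ L = 48) →
      (NumberField.InfinitePlace.mk ι₁).embedding = ι₁ →
      Nonempty ((thetaModelOf hHD hI h₁ h₃ (orientBitι L ι₁) (embOf hHD hI h₁ h₃) (coverOf hHD hI h₁ h₃ hA)
        (wmOfInput (HypCensus.Wcm hGR (@EtaChi.η @χV (@SInstance.χWR @hGR @hGR₀ @hGR₁ @μ)) (@EtaChi.hη @χV (@SInstance.χWR @hGR @hGR₀ @hGR₁ @μ))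
          (@EtaChi.hηc @χV (@SInstance.χWR @hGR @hGR₀ @hGR₁ @μ))))
        (thetaOf _ (thetaClassInputOf _ (fun V c => thetaSpaceInputOf hHD hI h₁ h₃ (SInstance.SROG @hGR @χV @hGR₀ @hGR₁ @hGR₂ @hGR₃ @μ hΔ₁ hΔ₂ hΔ₃) V c)))
        (d12Of μ) (d34Of μ)).Gen12FunBridge V c) :=
  fun {L} {ι₁} V c hc hK hcan =>
    gen12_ROG_of_GOG @hGR @χV @hGR₀ @hGR₁ @hGR₂ @hGR₃ @μ hΔ₁ hΔ₂ hΔ₃ hHD hI h₁ h₃ (orientBitι L ι₁) hA V c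
      ⟨hcan, (AdelicThetaCore.thetaModel_goodCtx_iff _ (orientBitι L ι₁) (d12Of μ) (d34Of μ) ι₁ c).mp hc⟩ hc hK.1

/-- **Row 17 (`real34`) IN E's OWN TEXT at the same pins**, from E's CM-inflation fact `h31`, ONE `hLiu` family in the oriented canonical text
(C3 up to CM-inflation at every good sextic canonical context, all types and levels — glue-1 `thetaSub_of_factOG`) and ONE (34) census side per
good sextic canonical context (mc-binder-2's core ⊕ `hwedge`, typed at the regime `isAnisotropic_of_goodCtx`).  Proof: § 1 `real34_ROG_of_GOG`
on the guard read off the row's hypotheses. -/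
theorem real34_ROGE (h31 : (picardCMUniverse hHD hI h₁ h₃).Fact_cmInflation)
    (hLiu : ∀ {L : CMField} {ι₁ : L →+* ℂ} (V : HermSpace3 L ι₁) (c : SeesawCtx L),
      (thetaModelOf hHD hI h₁ h₃ (orientBitι L ι₁) (embOf hHD hI h₁ h₃) (coverOf hHD hI h₁ h₃ hA)
        (wmOfInput (HypCensus.Wcm hGR (@EtaChi.η @χV (@SInstance.χWR @hGR @hGR₀ @hGR₁ @μ)) (@EtaChi.hη @χV (@SInstance.χWR @hGR @hGR₀ @hGR₁ @μ))
          (@EtaChi.hηc @χV (@SInstance.χWR @hGR @hGR₀ @hGR₁ @μ))))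
        (thetaOf _ (thetaClassInputOf _ (fun V c => thetaSpaceInputOf hHD hI h₁ h₃ (SInstance.SROG @hGR @χV @hGR₀ @hGR₁ @hGR₂ @hGR₃ @μ hΔ₁ hΔ₂ hΔ₃) V c)))
        (d12Of μ) (d34Of μ)).GoodCtx ι₁ c → Module.finrank ℚ c.K = 6 ∧ IsNormalClosure ℚ c.K L ∧ (Module.finrank ℚ L = 24 ∨ Module.finrank ℚ L = 48) →
      (NumberField.InfinitePlace.mk ι₁).embedding = ι₁ →
      ∀ (i : Fin 4) (Γ : Level V), ∃ (M : CMField) (k : c.K →+* M) (σ' : M →+* ℂ), σ'.comp k = c.σ ∧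
        (thetaModelOf hHD hI h₁ h₃ (orientBitι L ι₁) (embOf hHD hI h₁ h₃) (coverOf hHD hI h₁ h₃ hA)
          (wmOfInput (HypCensus.Wcm hGR (@EtaChi.η @χV (@SInstance.χWR @hGR @hGR₀ @hGR₁ @μ)) (@EtaChi.hη @χV (@SInstance.χWR @hGR @hGR₀ @hGR₁ @μ))
            (@EtaChi.hηc @χV (@SInstance.χWR @hGR @hGR₀ @hGR₁ @μ))))
          (thetaOf _ (thetaClassInputOf _ (fun V c => thetaSpaceInputOf hHD hI h₁ h₃ (SInstance.SROG @hGR @χV @hGR₀ @hGR₁ @hGR₂ @hGR₃ @μ hΔ₁ hΔ₂ hΔ₃) V c)))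
          (d12Of μ) (d34Of μ)).Theta V c i Γ ⊆
          (picardCMUniverse hHD hI h₁ h₃).Uiso Γ M (inflate k (c.Ψ i)) σ')
    (CS : ∀ {L : CMField} {ι₁ : L →+* ℂ} (V : HermSpace3 L ι₁) (c : SeesawCtx L)
      (hc : (thetaModelOf hHD hI h₁ h₃ (orientBitι L ι₁) (embOf hHD hI h₁ h₃) (coverOf hHD hI h₁ h₃ hA)
        (wmOfInput (HypCensus.Wcm hGR (@EtaChi.η @χV (@SInstance.χWR @hGR @hGR₀ @hGR₁ @μ)) (@EtaChi.hη @χV (@SInstance.χWR @hGR @hGR₀ @hGR₁ @μ))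
          (@EtaChi.hηc @χV (@SInstance.χWR @hGR @hGR₀ @hGR₁ @μ))))
        (thetaOf _ (thetaClassInputOf _ (fun V c => thetaSpaceInputOf hHD hI h₁ h₃ (SInstance.SROG @hGR @χV @hGR₀ @hGR₁ @hGR₂ @hGR₃ @μ hΔ₁ hΔ₂ hΔ₃) V c)))
        (d12Of μ) (d34Of μ)).GoodCtx ι₁ c) (hK : Module.finrank ℚ c.K = 6 ∧ IsNormalClosure ℚ c.K L ∧ (Module.finrank ℚ L = 24 ∨ Module.finrank ℚ L = 48)),
      (NumberField.InfinitePlace.mk ι₁).embedding = ι₁ →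
      Real34CensusSide @SInstance.GOG @SInstance.hG_GOG @hGR (@EtaChi.η @χV (@SInstance.χWR @hGR @hGR₀ @hGR₁ @μ))
        (@EtaChi.hη @χV (@SInstance.χWR @hGR @hGR₀ @hGR₁ @μ)) (@EtaChi.hηc @χV (@SInstance.χWR @hGR @hGR₀ @hGR₁ @μ)) @hGR₀ @hGR₁ @hGR₂ @hGR₃
        (@SInstance.AR @SInstance.GOG @SInstance.hG_GOG @hGR @χV @hGR₀ @hGR₁ @hGR₂ @hGR₃ @μ @SInstance.hpos_GOG
          (fun V c hc => hΔ₁ V c hc) (fun V c hc => hΔ₂ V c hc) (fun V c hc => hΔ₃ V c hc))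
        hHD hI h₁ h₃ @μ V c (isAnisotropic_of_goodCtx V hc hK.1)) :
    ∀ {L : CMField} {ι₁ : L →+* ℂ} (V : HermSpace3 L ι₁) (c : SeesawCtx L),
      (thetaModelOf hHD hI h₁ h₃ (orientBitι L ι₁) (embOf hHD hI h₁ h₃) (coverOf hHD hI h₁ h₃ hA)
        (wmOfInput (HypCensus.Wcm hGR (@EtaChi.η @χV (@SInstance.χWR @hGR @hGR₀ @hGR₁ @μ)) (@EtaChi.hη @χV (@SInstance.χWR @hGR @hGR₀ @hGR₁ @μ))
          (@EtaChi.hηc @χV (@SInstance.χWR @hGR @hGR₀ @hGR₁ @μ))))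
        (thetaOf _ (thetaClassInputOf _ (fun V c => thetaSpaceInputOf hHD hI h₁ h₃ (SInstance.SROG @hGR @χV @hGR₀ @hGR₁ @hGR₂ @hGR₃ @μ hΔ₁ hΔ₂ hΔ₃) V c)))
        (d12Of μ) (d34Of μ)).GoodCtx ι₁ c → Module.finrank ℚ c.K = 6 ∧ IsNormalClosure ℚ c.K L ∧ (Module.finrank ℚ L = 24 ∨ Module.finrank ℚ L = 48) →
      (NumberField.InfinitePlace.mk ι₁).embedding = ι₁ →
      Nonempty ((thetaModelOf hHD hI h₁ h₃ (orientBitι L ι₁) (embOf hHD hI h₁ h₃) (coverOf hHD hI h₁ h₃ hA)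
        (wmOfInput (HypCensus.Wcm hGR (@EtaChi.η @χV (@SInstance.χWR @hGR @hGR₀ @hGR₁ @μ)) (@EtaChi.hη @χV (@SInstance.χWR @hGR @hGR₀ @hGR₁ @μ))
          (@EtaChi.hηc @χV (@SInstance.χWR @hGR @hGR₀ @hGR₁ @μ))))
        (thetaOf _ (thetaClassInputOf _ (fun V c => thetaSpaceInputOf hHD hI h₁ h₃ (SInstance.SROG @hGR @χV @hGR₀ @hGR₁ @hGR₂ @hGR₃ @μ hΔ₁ hΔ₂ hΔ₃) V c)))
        (d12Of μ) (d34Of μ)).Real34FunBridge V c) :=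
  fun {L} {ι₁} V c hc hK hcan =>
    real34_ROG_of_GOG @hGR @χV @hGR₀ @hGR₁ @hGR₂ @hGR₃ @μ hΔ₁ hΔ₂ hΔ₃ hHD hI h₁ h₃ (orientBitι L ι₁) hA V c
      ⟨hcan, (AdelicThetaCore.thetaModel_goodCtx_iff _ (orientBitι L ι₁) (d12Of μ) (d34Of μ) ι₁ c).mp hc⟩ hc hK.1
      (fun Γ => thetaSub_of_factOG hHD hI h₁ h₃ orientBitι hA
        (HypCensus.Wcm hGR (@EtaChi.η @χV (@SInstance.χWR @hGR @hGR₀ @hGR₁ @μ)) (@EtaChi.hη @χV (@SInstance.χWR @hGR @hGR₀ @hGR₁ @μ))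
          (@EtaChi.hηc @χV (@SInstance.χWR @hGR @hGR₀ @hGR₁ @μ)))
        (fun V c => thetaSpaceInputOf hHD hI h₁ h₃ (SInstance.SROG @hGR @χV @hGR₀ @hGR₁ @hGR₂ @hGR₃ @μ hΔ₁ hΔ₂ hΔ₃) V c) μ h31 hLiu V c hc hK hcan 2 Γ)
      (fun Γ => thetaSub_of_factOG hHD hI h₁ h₃ orientBitι hA
        (HypCensus.Wcm hGR (@EtaChi.η @χV (@SInstance.χWR @hGR @hGR₀ @hGR₁ @μ)) (@EtaChi.hη @χV (@SInstance.χWR @hGR @hGR₀ @hGR₁ @μ))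
          (@EtaChi.hηc @χV (@SInstance.χWR @hGR @hGR₀ @hGR₁ @μ)))
        (fun V c => thetaSpaceInputOf hHD hI h₁ h₃ (SInstance.SROG @hGR @χV @hGR₀ @hGR₁ @hGR₂ @hGR₃ @μ hΔ₁ hΔ₂ hΔ₃) V c) μ h31 hLiu V c hc hK hcan 3 Γ)
      (CS V c hc hK hcan)

end Gen12PinsP

end HodgeCM.Model

end
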